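import Summits.QuantumFields.YangMills.Theorems.DiagonalMirrorRPRDiagClusterDefs
import Summits.QuantumFields.YangMills.Theorems.BalabanLadderNTReflectionCauchySchwarz
import Summits.QuantumFields.YangMills.Theorems.ConvexGribovBodyContinuumLegGivenGapStubRpShift
import HarnessLib

/-!
# Crux `WeakCouplingHypercubicLimitRP` (stmt-QuantumFields-27398), line `Sketch`, door B, R1-side:
# bookkeeping for the polarisation transport `RPSpectral → DiagCluster` (geometry, supports, invariance, positivity)

Helper file (`--supports stmt-QuantumFields-27398 --as helper`) of the crux lead `lead-27398-D1` g3 (docket director-ym g24,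
O4 WORD 37 internal plan (p1); critic idea-crit-9 g13 verdict #115 PASS-WITH-PRICE), first of two files proving the first lemma
of idea card `Cruxes/WeakCouplingHypercubicLimitRP/Ideas/axis-diagonal-polarisation-transport.md`,
`RPSpectral r sch Δ C → DiagCluster r sch Δ C` (the theorem itself is in the companion
`…PencilRigidityWeakCouplingHypercubicLimitRPDiagClusterOfRPSpectral`).  Contents — all soft, measure-preserving bookkeeping:

* §1 `ℤ⁴` geometry: the swap image `Y ∘ Σ` is `Y_B ∘ τ⁻¹ ∘ Θ` with `Y_B := Y ∘ Σ ∘ Θ ∘ τ` (`Σ = configPermZd (swap 0 1)`,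
  `Θ = gaugeTimeReflect` the bond reflection in `x₀ = −1/2`, `τᶜ = configShift (−c e₀)`); the diagonal shift splits
  `configShift (−n e₀ + n e₁) = configShift (n e₁) ∘ τⁿ`; the periodic lift of the torus bond reflection `Θ_T : t ↦ 1 − t` is
  `torusLift (Θ_T U) = τ⁻² Θ (torusLift U)` (pointwise);
* §2 supports: `Y_A := Y ∘ configShift (n e₁)` and `Y_B` are axis-slab-local in `{1 ≤ x₀ ≤ T}` when `Y` is `diagBox T`-local (the
  slab constrains `x₀` only — «one diagonal step advances `x₀` by one unit»); shifted lifts `Z ∘ τᵇ ∘ torusLift` of slab-local `Z`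
  are positive-half observables (`oPosEdges`) of the odd torus `2S+1` when `T + b ≤ S`;
* §3 invariance of Wilson's torus state along the lift under `Σ Θ τ` and `Θ_T` (from `integral_comp_configPerm_wilsonMeasure`,
  `rpShift_integral_gaugeTimeReflect_torusLift`, `rpShift_integral_configShift_torusLift`), and the identity «diagonal value of the
  reflection form on `Z ∘ τᵇ ∘ lift` = axis pairing of `Z` at shift `2b`» (`rpShift_integral_shift_pair`);
* §4 reflection positivity on the odd torus (`integral_mul_timeReflect_nonneg_odd`): `(∫ A)² ≤ ∫ A · A∘Θ_T` for positive-half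
  observables, and `∫ Z((Θ_T U)~) Z(Ũ) ≤ ∫ Z(Ũ)²`.

HONEST FRAMING: bookkeeping only; nothing here is a statement about the weak-coupling behaviour of Wilson's model.  D1′, the
crux ⟨27398⟩, its heart S6i and the summit are OPEN; the Yang–Mills mass gap is NOT proved here or anywhere in the tree.

References: Osterwalder–Seiler, Ann. Phys. 110 (1978) §2; Fröhlich–Israel–Lieb–Simon, CMP 62 (1978) Thm 2.1; Seiler, LNP 159
(1982) Ch. 2.
-/

set_option autoImplicit false

noncomputable section

open MeasureTheory Filter Topology
open Literature.MathematicalPhysics.QuantumLattice Literature.MathematicalPhysics.AQFT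
  Literature.MathematicalPhysics.QuantumFieldTheory
open Literature.MathematicalPhysics.QuantumFieldTheory.WilsonOddRP (oPosEdges oSharedEdges IsOPosEdge mem_oPosEdges)
open Summit.QuantumFields.YangMills.Cruxes.HypercubicLimit.CouplingResponse (RPSpectral)
open Summit.QuantumFields.YangMills.Theorems.ContinuumLegGivenGap
open Summit.QuantumFields.YangMills.Theorems.ClusteringToYangMills.Reconstructible
  (gaugeTimeReflect_gaugeTimeReflect measurable_gaugeTimeReflect)
open Summit.QuantumFields.YangMills.Cruxes.NT.Reflection
  (sq_cov_timeReflect_le_odd integral_mul_timeReflect_nonneg_odd integral_centred_mul_timeReflect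
    integrable_wilson_of_bdd)

namespace Summit.QuantumFields.YangMills.Cruxes.DiagonalMirrorRPR.SpectralTransfer


/-! ## §1 Geometry on `ℤ⁴`: the swap image and the diagonal shift in reflection-and-shift normal form -/

section Geometry

variable {G : Type} [Group G] [MeasurableSpace G]

/-- `Θ τ τ⁻¹ Θ = 1`: `gaugeTimeReflect (configShift (−e₀) (configShift (e₀) (gaugeTimeReflect V))) = V`
(`τ = configShift (−e₀)`, `Θ = gaugeTimeReflect` an involution). [folklore] -/
theorem gaugeTimeReflect_shift_unshift_gaugeTimeReflect (V : LGConfig 4 G) :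
    gaugeTimeReflect (configShift (-Pi.single 0 (1 : ℤ)) (configShift (-Pi.single 0 (-1 : ℤ)) (gaugeTimeReflect V))) =
      V := by
  rw [← configShift_add']
  have h : (-Pi.single 0 (1 : ℤ) + -Pi.single 0 (-1 : ℤ) : Fin 4 → ℤ) = 0 := by
    rw [Pi.single_neg, neg_neg, neg_add_cancel]
  rw [h, rpShift_configShift_zero, gaugeTimeReflect_gaugeTimeReflect]

/-- **The swap image in reflection normal form.**  For every functional `Y` of `ℤ⁴` gauge fields,
`Y (Σ V) = Y_B (τ⁻¹ Θ V)` with `Y_B := Y ∘ Σ ∘ Θ ∘ τ` (`Σ = configPermZd (swap 0 1)`). [folklore] -/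
theorem swap_eq_swapReflect_unshift (Y : LGConfig 4 G → ℝ) (V : LGConfig 4 G) :
    Y (configPermZd (Equiv.swap (0 : Fin 4) 1) V) =
      Y (configPermZd (Equiv.swap (0 : Fin 4) 1) (gaugeTimeReflect (configShift (-Pi.single 0 (1 : ℤ))
        (configShift (-Pi.single 0 (-1 : ℤ)) (gaugeTimeReflect V))))) := by
  rw [gaugeTimeReflect_shift_unshift_gaugeTimeReflect]

omit [Group G] in
/-- **The diagonal shift splits**: `configShift (−n e₀ + n e₁) = configShift (n e₁) ∘ configShift (−n e₀)`. [folklore] -/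
theorem configShift_diag_split (n : ℕ) (V : LGConfig 4 G) :
    configShift (-Pi.single 0 (n : ℤ) + Pi.single 1 (n : ℤ)) V =
      configShift (Pi.single 1 (n : ℤ)) (configShift (-Pi.single 0 (n : ℤ)) V) := by
  rw [← configShift_add', add_comm]

/-- The periodic lift intertwines `x ↦ x − 2e₀` followed by the `ℤ⁴` bond reflection `x₀ ↦ −1 − x₀` with the torus
bond reflection `t ↦ 1 − t` (spatial links). [folklore] -/
theorem proj_latticeTimeReflection_sub (N : ℕ) (x : Fin 4 → ℤ) :
    Literature.Probability.LatticeModels.Torus.proj N (latticeTimeReflection 4 (x - -Pi.single 0 (-2 : ℤ))) =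
      Site.timeReflect (Literature.Probability.LatticeModels.Torus.proj N x : Site 4 N) := by
  funext j
  by_cases hj : j = 0
  · subst hj
    simp only [Literature.Probability.LatticeModels.Torus.proj_apply, latticeTimeReflection_apply,
      Function.update_self, Pi.sub_apply, Pi.neg_apply, Pi.single_eq_same, Site.timeReflect]
    push_cast
    ring
  · simp only [Literature.Probability.LatticeModels.Torus.proj_apply, latticeTimeReflection_apply,
      Function.update_of_ne hj, Pi.sub_apply, Pi.neg_apply, Pi.single_eq_of_ne hj, Site.timeReflect,
      neg_zero, sub_zero]

/-- The same for temporal links: `proj (θ (x − 2e₀ + e₀)) = θ_T ((proj x) + e₀)`. [folklore] -/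
theorem proj_latticeTimeReflection_sub_add (N : ℕ) (x : Fin 4 → ℤ) :
    Literature.Probability.LatticeModels.Torus.proj N
        (latticeTimeReflection 4 (x - -Pi.single 0 (-2 : ℤ) + Pi.single 0 1)) =
      Site.timeReflect (Site.shift (Literature.Probability.LatticeModels.Torus.proj N x : Site 4 N) 0) := by
  funext j
  by_cases hj : j = 0
  · subst hj
    simp only [Literature.Probability.LatticeModels.Torus.proj_apply, latticeTimeReflection_apply,
      Function.update_self, Pi.sub_apply, Pi.add_apply, Pi.neg_apply, Pi.single_eq_same, Site.timeReflect,
      Site.shift]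
    push_cast
    ring
  · simp only [Literature.Probability.LatticeModels.Torus.proj_apply, latticeTimeReflection_apply,
      Function.update_of_ne hj, Pi.sub_apply, Pi.add_apply, Pi.neg_apply, Pi.single_eq_of_ne hj, Site.timeReflect,
      Site.shift, neg_zero, sub_zero, add_zero]

/-- **The periodic lift of the torus bond reflection `Θ_T` in `ℤ⁴` normal form**:
`torusLift N (Θ_T U) = τ⁻² (Θ (torusLift N U))` (`τ⁻² = configShift (−(−2) e₀)`). [folklore] -/
theorem torusLift_timeReflect {N : ℕ} (U : GaugeConfig 4 N G) :
    torusLift N U.timeReflect = configShift (-Pi.single 0 (-2 : ℤ)) (gaugeTimeReflect (torusLift N U)) := by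
  funext e
  obtain ⟨x, i⟩ := e
  simp only [torusLift, Function.comp_apply, torusEdge, configShift_apply, gaugeTimeReflect_apply,
    GaugeConfig.timeReflect]
  by_cases hi : i = 0
  · rw [if_pos hi, if_pos hi, proj_latticeTimeReflection_sub_add]
  · rw [if_neg hi, if_neg hi, proj_latticeTimeReflection_sub]

/-- `τᵇ (torusLift N (Θ_T U)) = τ^{b−2} (Θ (torusLift N U))`. [folklore] -/
theorem configShift_torusLift_timeReflect {N : ℕ} (b : ℤ) (U : GaugeConfig 4 N G) :
    configShift (-Pi.single 0 b) (torusLift N U.timeReflect) =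
      configShift (-Pi.single 0 (b - 2)) (gaugeTimeReflect (torusLift N U)) := by
  rw [torusLift_timeReflect, rpShift_configShift_configShift]
  congr 3
  ring

end Geometry

/-! ## §2 Supports: the transported functionals are axis-slab-local, their shifted lifts are positive-half observables -/

section Support

variable {G : Type} [Group G] [MeasurableSpace G]

omit [Group G] in
/-- `Y_A := Y ∘ configShift (n e₁)` of a `diagBox T`-local `Y` is axis-slab-local in `{1 ≤ x₀ ≤ T}` (the slab constrains
`x₀` only — the lever «one diagonal step advances `x₀` by one unit»). [folklore] -/
theorem dependsOn_shiftOne {T : ℕ} {Y : LGConfig 4 G → ℝ} (hY : DependsOn Y (diagBox T)) (n : ℕ) :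
    DependsOn (fun W : LGConfig 4 G => Y (configShift (Pi.single 1 (n : ℤ)) W))
      {e : Literature.MathematicalPhysics.QuantumLattice.ZdEdge 4 |
        1 ≤ e.1 0 ∧ e.1 0 + (if e.2 = 0 then 1 else 0) ≤ T} := by
  intro W W' h
  apply hY
  intro e he
  obtain ⟨h1, h2, -, -⟩ := he
  simp only [configShift_apply]
  apply h
  have h0 : (e.1 - Pi.single 1 (n : ℤ) : Fin 4 → ℤ) 0 = e.1 0 := by simp
  simp only [Set.mem_setOf_eq]
  rw [h0]
  exact ⟨h1, h2⟩

/-- `Y_B := Y ∘ Σ ∘ Θ ∘ τ` of a `diagBox T`-local `Y` is axis-slab-local in `{1 ≤ x₀ ≤ T}`: the swap carries the box to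
`{−T ≤ x₀ ≤ −1}`, the bond reflection `Θ` (plane `x₀ = −1/2`) to `{0 ≤ x₀ ≤ T−1}`, the unit shift to `{1 ≤ x₀ ≤ T}`. [folklore] -/
theorem dependsOn_swapReflectShift {T : ℕ} {Y : LGConfig 4 G → ℝ} (hY : DependsOn Y (diagBox T)) :
    DependsOn (fun W : LGConfig 4 G => Y (configPermZd (Equiv.swap (0 : Fin 4) 1)
        (gaugeTimeReflect (configShift (-Pi.single 0 (1 : ℤ)) W))))
      {e : Literature.MathematicalPhysics.QuantumLattice.ZdEdge 4 |
        1 ≤ e.1 0 ∧ e.1 0 + (if e.2 = 0 then 1 else 0) ≤ T} := by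
  intro W W' h
  apply hY
  intro e he
  obtain ⟨h1, h2, h3, h4⟩ := he
  have hx1 : sitePermZd (Equiv.swap (0 : Fin 4) 1) e.1 0 = e.1 1 := by
    simp [sitePermZd_apply]
  simp only [configPermZd_apply, Equiv.symm_swap, gaugeTimeReflect_apply, configShift_apply]
  by_cases hi : e.2 = 1
  · have hσ : Equiv.swap (0 : Fin 4) 1 e.2 = 0 := by rw [hi, Equiv.swap_apply_right]
    simp only [if_pos hσ]
    rw [hi, if_pos rfl] at h4
    congr 1
    apply h
    have ht : (latticeTimeReflection 4 (sitePermZd (Equiv.swap (0 : Fin 4) 1) e.1 + Pi.single 0 1) -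
        -Pi.single 0 (1 : ℤ) : Fin 4 → ℤ) 0 = -1 - e.1 1 := by
      rw [Pi.sub_apply, latticeTimeReflection_apply, Function.update_self, Pi.add_apply, hx1]
      simp only [Pi.single_eq_same, Pi.neg_apply]
      ring
    simp only [Set.mem_setOf_eq, ht, if_true]
    constructor <;> omega
  · have hσ : Equiv.swap (0 : Fin 4) 1 e.2 ≠ 0 := by
      intro h0
      apply hi
      have := congrArg (Equiv.swap (0 : Fin 4) 1) h0
      rwa [Equiv.swap_apply_self, Equiv.swap_apply_left] at this
    simp only [if_neg hσ]
    rw [if_neg hi] at h4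
    apply h
    have ht : (latticeTimeReflection 4 (sitePermZd (Equiv.swap (0 : Fin 4) 1) e.1) -
        -Pi.single 0 (1 : ℤ) : Fin 4 → ℤ) 0 = -e.1 1 := by
      rw [Pi.sub_apply, latticeTimeReflection_apply, Function.update_self, hx1]
      simp only [Pi.single_eq_same, Pi.neg_apply]
      ring
    simp only [Set.mem_setOf_eq, ht, if_neg hσ]
    constructor <;> omega

/-- The time coordinate of the projection of a site of `ℤ⁴` with `0 ≤ x₀ ≤ 2S` to the torus of side `2S+1`. [folklore] -/
theorem val_proj_zero {S : ℕ} (y : Fin 4 → ℤ) (h0 : 0 ≤ y 0) (h1 : y 0 ≤ 2 * S) :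
    (((Literature.Probability.LatticeModels.Torus.proj (2 * S + 1) y) 0).val : ℤ) = y 0 := by
  rw [Literature.Probability.LatticeModels.Torus.proj_apply, ZMod.val_intCast]
  exact Int.emod_eq_of_lt h0 (by push_cast; omega)

omit [Group G] in
/-- **A shifted lift of an axis-slab-local functional is a positive-half observable of the odd torus**: if `Z` depends on
the links of `{1 ≤ x₀ ≤ T}` and `T + b ≤ S`, then `U ↦ Z (τᵇ (torusLift (2S+1) U))` depends only on the links based at torus
times `1 … S` (`oPosEdges`). [folklore] -/
theorem dependsOn_shift_torusLift {S T b : ℕ} {Z : LGConfig 4 G → ℝ}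
    (hZ : DependsOn Z {e : Literature.MathematicalPhysics.QuantumLattice.ZdEdge 4 |
      1 ≤ e.1 0 ∧ e.1 0 + (if e.2 = 0 then 1 else 0) ≤ T}) (hb : T + b ≤ S) :
    DependsOn (fun U : GaugeConfig 4 (2 * S + 1) G => Z (configShift (-Pi.single 0 (b : ℤ)) (torusLift (2 * S + 1) U)))
      ((oPosEdges ∪ oSharedEdges : Finset (Edge 4 (2 * S + 1))) : Set (Edge 4 (2 * S + 1))) := by
  intro U V h
  apply hZ
  intro e he
  obtain ⟨h1, h2⟩ := he
  have hite : (0 : ℤ) ≤ (if e.2 = 0 then 1 else 0) := by split_ifs <;> norm_num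
  simp only [configShift_apply, torusLift, Function.comp_apply, torusEdge]
  apply h
  simp only [Finset.coe_union, Set.mem_union, Finset.mem_coe, mem_oPosEdges, IsOPosEdge]
  left
  have hy : (e.1 - -Pi.single 0 (b : ℤ) : Fin 4 → ℤ) 0 = e.1 0 + b := by simp
  have hv := val_proj_zero (S := S) (e.1 - -Pi.single 0 (b : ℤ) : Fin 4 → ℤ) (by rw [hy]; omega) (by rw [hy]; omega)
  rw [hy] at hv
  constructor <;> omega

omit [Group G] [MeasurableSpace G] in
/-- The unshifted case: `U ↦ Z (torusLift (2S+1) U)` is a positive-half observable when `T ≤ S`. [folklore] -/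
theorem dependsOn_torusLift {S T : ℕ} {Z : LGConfig 4 G → ℝ}
    (hZ : DependsOn Z {e : Literature.MathematicalPhysics.QuantumLattice.ZdEdge 4 |
      1 ≤ e.1 0 ∧ e.1 0 + (if e.2 = 0 then 1 else 0) ≤ T}) (hT : T ≤ S) :
    DependsOn (fun U : GaugeConfig 4 (2 * S + 1) G => Z (torusLift (2 * S + 1) U))
      ((oPosEdges ∪ oSharedEdges : Finset (Edge 4 (2 * S + 1))) : Set (Edge 4 (2 * S + 1))) := by
  intro U V h
  apply hZ
  intro e he
  obtain ⟨h1, h2⟩ := he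
  have hite : (0 : ℤ) ≤ (if e.2 = 0 then 1 else 0) := by split_ifs <;> norm_num
  simp only [torusLift, Function.comp_apply, torusEdge]
  apply h
  simp only [Finset.coe_union, Set.mem_union, Finset.mem_coe, mem_oPosEdges, IsOPosEdge]
  left
  have hv := val_proj_zero (S := S) e.1 (by omega) (by omega)
  constructor <;> omega

end Support

/-! ## §3 Invariance of Wilson's torus state: means and second moments of the transported functionals -/

section Invariance

variable {G : Type} [Group G] [TopologicalSpace G] [IsTopologicalGroup G] [CompactSpace G]
  [MeasurableSpace G] [BorelSpace G] {N : ℕ} (ρ : G →* Matrix (Fin N) (Fin N) ℂ)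

/-- **`Σ Θ τ` preserves Wilson's torus state along the lift**: `∫ H(Σ Θ τ Ũ) dμ = ∫ H(Ũ) dμ` (translation invariance,
reflection invariance `rpShift_integral_gaugeTimeReflect_torusLift`, axis-permutation invariance
`integral_comp_configPerm_wilsonMeasure` read through `configPermZd_torusLift`). [folklore] -/
theorem integral_swapReflectShift_torusLift (hρ : Continuous ρ) (β : ℝ) (L : ℕ) [NeZero L]
    (H : LGConfig 4 G → ℝ) :
    ∫ U, H (configPermZd (Equiv.swap (0 : Fin 4) 1) (gaugeTimeReflect (configShift (-Pi.single 0 (1 : ℤ))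
        (torusLift L U)))) ∂(wilsonMeasure (d := 4) (L := L) ρ β) =
      ∫ U, H (torusLift L U) ∂(wilsonMeasure (d := 4) (L := L) ρ β) := by
  have h1 := rpShift_integral_configShift_torusLift ρ β L (-Pi.single 0 (1 : ℤ))
    (fun W => H (configPermZd (Equiv.swap (0 : Fin 4) 1) (gaugeTimeReflect W)))
  have h2 := rpShift_integral_gaugeTimeReflect_torusLift ρ hρ β L
    (fun W => H (configPermZd (Equiv.swap (0 : Fin 4) 1) W))
  rw [h1, h2]
  simp_rw [configPermZd_torusLift]
  exact integral_comp_configPerm_wilsonMeasure ρ hρ β _ (fun U => H (torusLift L U))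

/-- **`Θ_T`-invariance along the lift**: `∫ H(torusLift (Θ_T U)) dμ = ∫ H(torusLift U) dμ`. [folklore] -/
theorem integral_torusLift_timeReflect (hρ : Continuous ρ) (β : ℝ) (L : ℕ) [NeZero L] (H : LGConfig 4 G → ℝ) :
    ∫ U, H (torusLift L U.timeReflect) ∂(wilsonMeasure (d := 4) (L := L) ρ β) =
      ∫ U, H (torusLift L U) ∂(wilsonMeasure (d := 4) (L := L) ρ β) := by
  simp_rw [torusLift_timeReflect]
  have h1 := rpShift_integral_gaugeTimeReflect_torusLift ρ hρ β L
    (fun W => H (configShift (-Pi.single 0 (-2 : ℤ)) W))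
  have h2 := rpShift_integral_configShift_torusLift ρ β L (-Pi.single 0 (-2 : ℤ)) H
  rw [h1, h2]

/-- **The diagonal value of the reflection form on a shifted lift is the axis pairing at the doubled shift**:
`∫ Z(τᵇŨ) · Z(τᵇ (Θ_T U)~) dμ = ∫ Z((Θ_T U)~) · Z(τ^{2b} Ũ) dμ` (`τᵇ Θ = Θ τ^{−b}` and translation invariance,
`rpShift_integral_shift_pair`). [folklore] -/
theorem integral_shift_mul_shift_timeReflect (β : ℝ) (L : ℕ) [NeZero L] (Z : LGConfig 4 G → ℝ) (b : ℕ) :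
    ∫ U, Z (configShift (-Pi.single 0 (b : ℤ)) (torusLift L U)) *
        Z (configShift (-Pi.single 0 (b : ℤ)) (torusLift L U.timeReflect)) ∂(wilsonMeasure (d := 4) (L := L) ρ β) =
      ∫ U, Z (torusLift L U.timeReflect) * Z (configShift (-Pi.single 0 ((2 * b : ℕ) : ℤ)) (torusLift L U))
        ∂(wilsonMeasure (d := 4) (L := L) ρ β) := by
  simp_rw [configShift_torusLift_timeReflect, torusLift_timeReflect]
  have h1 := rpShift_integral_shift_pair ρ β L Z Z ((b : ℤ) - 2) (b : ℤ)
  have h2 := rpShift_integral_shift_pair ρ β L Z Z (-2 : ℤ) ((2 * b : ℕ) : ℤ)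
  have h12 : ((b : ℤ) - 2) + (b : ℤ) = -2 + ((2 * b : ℕ) : ℤ) := by push_cast; ring
  rw [h12] at h1
  rw [h2, ← h1]
  refine integral_congr_ae (ae_of_all _ fun U => ?_)
  simp only
  ring

end Invariance

/-! ## §4 Reflection positivity on the odd torus for shifted lifts of slab-local functionals -/

section Positivity

variable {G : Type} [Group G] [TopologicalSpace G] [IsTopologicalGroup G] [CompactSpace G]
  [MeasurableSpace G] [BorelSpace G] {N : ℕ} (ρ : G →* Matrix (Fin N) (Fin N) ℂ)

/-- **RP lower bound**: for a bounded measurable positive-half observable `A` of the odd torus `2S+1` (`S ≥ 1`, `β ≥ 0`),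
`(∫ A)² ≤ ∫ A · A∘Θ_T` (reflection positivity of the centred observable). [cite: OsterwalderSeiler1978, §2] -/
theorem sq_integral_le_integral_mul_timeReflect {S : ℕ} (hS : 1 ≤ S) (hρ : Continuous ρ) {β : ℝ} (hβ : 0 ≤ β)
    {A : GaugeConfig 4 (2 * S + 1) G → ℝ} (hAm : Measurable A) (hAb : ∃ K : ℝ, ∀ U, |A U| ≤ K)
    (hAdep : DependsOn A ((oPosEdges ∪ oSharedEdges : Finset (Edge 4 (2 * S + 1))) : Set (Edge 4 (2 * S + 1)))) :
    (∫ U, A U ∂(wilsonMeasure ρ β)) ^ 2 ≤ ∫ U, A U * A U.timeReflect ∂(wilsonMeasure ρ β) := by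
  have hodd : Odd (2 * S + 1) := ⟨S, rfl⟩
  have h3 : 3 ≤ 2 * S + 1 := by omega
  obtain ⟨K, hK⟩ := hAb
  have hcm : Measurable fun U => A U - ∫ V, A V ∂(wilsonMeasure ρ β) := hAm.sub measurable_const
  have hcb : ∃ K' : ℝ, ∀ U, |A U - ∫ V, A V ∂(wilsonMeasure ρ β)| ≤ K' :=
    ⟨K + |∫ V, A V ∂(wilsonMeasure ρ β)|, fun U => (abs_sub _ _).trans (by linarith [hK U])⟩
  have hcdep : DependsOn (fun U => A U - ∫ V, A V ∂(wilsonMeasure ρ β))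
      ((oPosEdges ∪ oSharedEdges : Finset (Edge 4 (2 * S + 1))) : Set (Edge 4 (2 * S + 1))) :=
    fun U V hUV => by simp only; rw [hAdep hUV]
  have hpos := integral_mul_timeReflect_nonneg_odd ρ hodd h3 hρ hβ hcm hcb hcdep
  have hcen := integral_centred_mul_timeReflect ρ hρ β hAm hAm ⟨K, hK⟩ ⟨K, hK⟩
  rw [hcen] at hpos
  nlinarith [hpos]

/-- **The reflection pairing is dominated by the second moment**: `∫ H((Θ_T U)~) · H(Ũ) ≤ ∫ H(Ũ)²` (`2xy ≤ x² + y²` and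
`Θ_T`-invariance of the state). [folklore] -/
theorem integral_timeReflect_mul_le_sq (hρ : Continuous ρ) (β : ℝ) (L : ℕ) [NeZero L]
    {H : LGConfig 4 G → ℝ} (hHm : Measurable H) {B : ℝ} (hHb : ∀ V, |H V| ≤ B) :
    ∫ U, H (torusLift L U.timeReflect) * H (torusLift L U) ∂(wilsonMeasure (d := 4) (L := L) ρ β) ≤
      ∫ U, (H (torusLift L U)) ^ 2 ∂(wilsonMeasure (d := 4) (L := L) ρ β) := by
  haveI := isProbabilityMeasure_wilsonMeasure (d := 4) (L := L) ρ hρ β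
  have hΘm : Measurable (GaugeConfig.timeReflect : GaugeConfig 4 L G → GaugeConfig 4 L G) :=
    WilsonRP.measurable_timeReflect
  have hm1 : Measurable fun U : GaugeConfig 4 L G => H (torusLift L U) := hHm.comp (measurable_torusLift _)
  have hm2 : Measurable fun U : GaugeConfig 4 L G => H (torusLift L U.timeReflect) :=
    hHm.comp ((measurable_torusLift _).comp hΘm)
  have hb1 : ∀ U : GaugeConfig 4 L G, |H (torusLift L U)| ≤ B := fun U => hHb _
  have hb2 : ∀ U : GaugeConfig 4 L G, |H (torusLift L U.timeReflect)| ≤ B := fun U => hHb _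
  have hB0 : 0 ≤ B := (abs_nonneg _).trans (hHb (Classical.arbitrary _))
  have iprod : Integrable (fun U => H (torusLift L U.timeReflect) * H (torusLift L U)) (wilsonMeasure ρ β) :=
    integrable_wilson_of_bdd ρ hρ β (hm2.mul hm1) ⟨B * B, fun U => by
      rw [abs_mul]; exact mul_le_mul (hb2 U) (hb1 U) (abs_nonneg _) hB0⟩
  have isq1 : Integrable (fun U => (H (torusLift L U)) ^ 2) (wilsonMeasure ρ β) :=
    integrable_wilson_of_bdd ρ hρ β (hm1.pow_const 2) ⟨B ^ 2, fun U => by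
      rw [abs_pow]; exact pow_le_pow_left₀ (abs_nonneg _) (hb1 U) 2⟩
  have isq2 : Integrable (fun U => (H (torusLift L U.timeReflect)) ^ 2) (wilsonMeasure ρ β) :=
    integrable_wilson_of_bdd ρ hρ β (hm2.pow_const 2) ⟨B ^ 2, fun U => by
      rw [abs_pow]; exact pow_le_pow_left₀ (abs_nonneg _) (hb2 U) 2⟩
  have hsq : ∫ U, (H (torusLift L U.timeReflect)) ^ 2 ∂(wilsonMeasure ρ β) =
      ∫ U, (H (torusLift L U)) ^ 2 ∂(wilsonMeasure ρ β) :=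
    integral_torusLift_timeReflect ρ hρ β L (fun V => (H V) ^ 2)
  have hle : ∫ U, H (torusLift L U.timeReflect) * H (torusLift L U) ∂(wilsonMeasure ρ β) ≤
      ∫ U, ((H (torusLift L U.timeReflect)) ^ 2 + (H (torusLift L U)) ^ 2) / 2 ∂(wilsonMeasure ρ β) := by
    refine integral_mono iprod ((isq2.add isq1).div_const 2) fun U => ?_
    simp only
    nlinarith [sq_nonneg (H (torusLift L U.timeReflect) - H (torusLift L U))]
  refine hle.trans (le_of_eq ?_)
  rw [integral_div, integral_add isq2 isq1, hsq]
  ring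

end Positivity

end Summit.QuantumFields.YangMills.Cruxes.DiagonalMirrorRPR.SpectralTransfer

end
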